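import Summits.CriticalPhenomena.PercolationContinuityZ3.Theorems.PercNearOneGluingNoHeavyPcintMeanMemKernelCert
import HarnessLib

/-!
# PCINT lane, reduced-state B3m certificates (bond): the FAST kernel format — computable layer

Cell `prim-pcint` (PAPER-2 track (iii)), seat `prim-pcint-2` (gen 11); support file (`--supports stmt-CriticalPhenomena-4575`).
Does NOT build on p205010.  A second kernel-evaluable mirror of the B3m dangerous-set automaton of `…PcintMeanMem`, designed for
`decide +kernel` speed and for compact table literals (memo `run/shared/lean/prim/pcint/EFFICIENCY.md` §7):
* states `BondF.FState` are lists of (SHIFTED natural coordinates `x + B`, age) — natural-number arithmetic only (the kernel's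
  GMP fast path), no integer lists;
* every geometric predicate is a PROBE `BondF.ageAt P w` (the age remembered at a site near the endpoint, `0` if none; `P` =
  the row's LOCAL MAP `BondF.locOf`: the remembered sites within `ℓ¹`-distance `3`, keyed by a base-`64` site code, found through
  a base-`32` cell directory — `O(1)` natural-number operations per probe, hits re-verified, completeness re-checked per row by
  `BondF.selfOK`), instead of the `O(|L|·d)` adjacency scans of `…PcintChordMemKernel`/`…ChainMemKernel`/`…ThirdMemKernel`/`…MeanMemKernel`;
* absence / existence of incidences is first read off OCCUPANCY MASKS (`BondF.occOf`: OR of `2^{cell}` over near sites, tested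
  against the constant neighbour masks `BondF.nbMask` with one `&&&`);
* successor states are compared as LISTS (`BondF.eqFS`, states kept age-sorted), not as sets;
* table rows are `(V, S, J)`: the Collatz–Wielandt weight, the state as ONE natural number (letters of a realising path, base `32`,
  decoded by `BondF.decS` — the decoder needs no correctness theorem: its output IS the row's state), and the per-letter successor
  data `1 + c + nsym·j` (`0` = rejection).
Denotation `BondF.toMF`, the soundness bridges and the certificate theorem `BondF.le_criticalProb_of_checkRowsF` are in
`…PcintMeanMemFastSound` / `…PcintMeanMemFastCert`.
-/

namespace Summit.CriticalPhenomena.PercolationContinuityZ3.Theorems.Pcint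

open Literature.Probability.Percolation Literature.Probability.LatticeModels

namespace BondF

open NawK (letters letterIdx)

/-! ### Shifted natural coordinates -/

/-- Fast kernel states: lists of (site as SHIFTED natural coordinates `x_k + B`, age). [folklore] -/
abbrev FState : Type := List (List ℕ × ℕ)

/-- Change coordinate `i` of a shifted site by `±1`. [folklore] -/
def addU : List ℕ → ℕ → Bool → List ℕ
  | [], _, _ => []
  | x :: v, 0, up => (if up then x + 1 else x - 1) :: v
  | x :: v, i + 1, up => x :: addU v i up

/-- The origin, shifted. [folklore] -/
def origF (d B : ℕ) : List ℕ := List.replicate d B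

/-- The lattice neighbour `e_a` of the origin (letter number `2i` is `+e_i`, `2i+1` is `-e_i`), shifted. [folklore] -/
def unitF (d B : ℕ) (a : Fin d × Bool) : List ℕ := addU (origF d B) a.1.1 a.2

/-- `ℓ¹` norm of a shifted site. [folklore] -/
def l1F (B : ℕ) : List ℕ → ℕ
  | [] => 0
  | x :: v => (if B ≤ x then x - B else B - x) + l1F B v

/-! ### Site codes and the local map -/

/-- Base-`64` code of a shifted site (injective on sites with coordinates `< 64`). [folklore] -/
def code64 : List ℕ → ℕ
  | [] => 0
  | x :: v => x + 64 * code64 v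

/-- Base-`7` cell number of a shifted site within `ℓ∞`-distance `3` of the endpoint (directory slot of the local map). [folklore] -/
def cell7 (B : ℕ) : List ℕ → ℕ
  | [] => 0
  | x :: v => (x + 3 - B) + 7 * cell7 B v

/-- The NEAR entries of a state (`ℓ¹`-distance `≤ 3` from the endpoint) as (code, cell, age). [folklore] -/
def nearL (B : ℕ) (L : FState) : List (ℕ × ℕ × ℕ) :=
  L.filterMap fun e => if l1F B e.1 ≤ 3 then some (code64 e.1, cell7 B e.1, e.2) else none

/-- Cell directory: `Σ (position + 1) · 32^{cell}` over the near entries. [folklore] -/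
def dirOf : List (ℕ × ℕ × ℕ) → ℕ → ℕ
  | [], _ => 0
  | e :: t, i => i * 32 ^ e.2.1 + dirOf t (i + 1)

/-- Occupancy mask: the OR of `2^{cell}` over the near entries whose age passes `p`. [folklore] -/
def occOf (p : ℕ → Bool) : List (ℕ × ℕ × ℕ) → ℕ
  | [] => 0
  | e :: t => if p e.2.2 then 2 ^ e.2.1 ||| occOf p t else occOf p t

/-- The LOCAL MAP of a state: (cell directory, near entries, masks of all / age `≥ 2` / age `+ 1 ≤ kc` near sites). [folklore] -/
abbrev LMap : Type := ℕ × List (ℕ × ℕ × ℕ) × ℕ × ℕ × ℕ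

/-- The local map of a state. [folklore] -/
def locOf (B kc : ℕ) (L : FState) : LMap :=
  (dirOf (nearL B L) 1, nearL B L, occOf (fun _ => true) (nearL B L), occOf (fun g => decide (2 ≤ g)) (nearL B L),
    occOf (fun g => decide (g + 1 ≤ kc)) (nearL B L))

/-- Mask of a list of (shifted) sites: the OR of `2^{cell}`. [folklore] -/
def maskOf (B : ℕ) : List (List ℕ) → ℕ
  | [] => 0
  | v :: t => 2 ^ cell7 B v ||| maskOf B t

/-- Mask of the `2d` lattice neighbours of `w`. [folklore] -/
def nbMask (d B : ℕ) (w : List ℕ) : ℕ := maskOf B ((letters d).map fun k => addU w k.1.1 k.2)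

/-- PROBE the local map at the site with (code, cell) `cw`: the directory names a candidate entry, whose code is re-checked;
returns its age, or `0`. [folklore] -/
def probe (P : LMap) (cw : ℕ × ℕ) : ℕ :=
  match P.1 / 32 ^ cw.2 % 32 with
  | 0 => 0
  | i + 1 => match P.2.1[i]? with
    | some e => if e.1 == cw.1 then e.2.2 else 0
    | none => 0

/-- The age remembered at the (near) shifted site `w`, read from the local map. [folklore] -/
def ageAt (B : ℕ) (P : LMap) (w : List ℕ) : ℕ := probe P (code64 w, cell7 B w)

/-- The probe at the lattice neighbour of `w` in direction `k`. [folklore] -/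
def nbAge {d : ℕ} (B : ℕ) (P : LMap) (w : List ℕ) (k : Fin d × Bool) : ℕ := ageAt B P (addU w k.1.1 k.2)

/-- SELF-CHECK of the local map: every near entry is found, with its age, by the probe at its own site (this is what makes
absent probes meaningful; no arithmetic fact about the directory is ever used). [folklore] -/
def selfOK (P : LMap) : Bool := P.2.1.all fun e => probe P (e.1, e.2.1) == e.2.2

/-! ### The per-site unit classification (B3m bookkeeping, probe form) -/

section Units

variable (d B τ kc : ℕ) (P : LMap)

/-- The neighbour `w = e_a + e_b` of the new vertex, shifted. [folklore] -/
def nbF (a b : Fin d × Bool) : List ℕ := addU (unitF d B a) b.1.1 b.2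

/-- DET-PAYING test of `w = e_a + e_b` (mask form): not the origin, not remembered, an incidence of age `≥ 2`, an incidence
of age `+ 1 ≤ kc`. [folklore] -/
def payF (a b : Fin d × Bool) : Bool :=
  !(decide (b.1 = a.1) && !(b.2 == a.2)) && (P.2.2.1 &&& 2 ^ cell7 B (nbF d B a b) == 0) &&
    !(P.2.2.2.1 &&& nbMask d B (nbF d B a b) == 0) && !(P.2.2.2.2 &&& nbMask d B (nbF d B a b) == 0)

/-- BONUS test at `w = e_a + e_b`: an incidence (direction `k`) of age `g₁` with `g₁ + 1 ≤ kc`, `g₁ + kc + 3 ≤ τ`, and every incidence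
in another direction older than `g₁ + kc`. [folklore] -/
def bonusF (a b : Fin d × Bool) : Bool :=
  (letters d).any fun k => 1 ≤ nbAge B P (nbF d B a b) k && nbAge B P (nbF d B a b) k + 1 ≤ kc &&
    nbAge B P (nbF d B a b) k + kc + 3 ≤ τ &&
    (letters d).all fun k' => decide (k' = k) || (nbAge B P (nbF d B a b) k' == 0) ||
      decide (nbAge B P (nbF d B a b) k + kc < nbAge B P (nbF d B a b) k')

/-- T-SITE test at `w = e_a + e_b`: det-paying, at least two incidences, all of age `≥ 3`. [folklore] -/
def tF (a b : Fin d × Bool) : Bool :=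
  payF d B P a b && decide (2 ≤ ((letters d).filter fun k => !(nbAge B P (nbF d B a b) k == 0)).length) &&
    (letters d).all fun k => (nbAge B P (nbF d B a b) k == 0) || decide (3 ≤ nbAge B P (nbF d B a b) k)

/-- CORNER-THIRD test at `w = e_a + e_b`: det-paying, `b ⟂ a`, and `e_b` is the remembered site of age `1`. [folklore] -/
def m3F (a b : Fin d × Bool) : Bool :=
  payF d B P a b && !decide (b.1 = a.1) && (ageAt B P (unitF d B b) == 1)

/-- Number of deterministic units claimed for the step `a`: det-paying sites plus bonuses. [folklore] -/
def cdetF (a : Fin d × Bool) : ℕ :=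
  ((letters d).filter fun b => payF d B P a b).length +
    ((letters d).filter fun b => payF d B P a b && bonusF d B τ kc P a b).length

/-- Number of `t`-units claimed for the step `a`. [folklore] -/
def utF (a : Fin d × Bool) : ℕ := ((letters d).filter fun b => tF d B P a b).length

/-- Number of corner-third units claimed for the step `a`. [folklore] -/
def umF (a : Fin d × Bool) : ℕ := ((letters d).filter fun b => m3F d B P a b).length

/-- Claimed chord count of the step `a`: remembered lattice neighbours of the new vertex `e_a`. [folklore] -/
def chordF (a : Fin d × Bool) : ℕ :=
  ((letters d).filter fun k => !(P.2.2.1 &&& 2 ^ cell7 B (addU (unitF d B a) k.1.1 k.2) == 0)).length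

/-- Claimed corner of the step `a` (read off the state `L` and its local map): the age-`1` site `q₁` is a lattice neighbour of the
endpoint orthogonal to `a`, and the corner site `q₁ + e_a` is neither remembered nor incident to a remembered site of age `≥ 2`.
[folklore] -/
def cornerF (L : FState) (a : Fin d × Bool) : Bool :=
  match L.find? fun e => e.2 == 1 with
  | none => false
  | some e => (l1F B e.1 == 1) && (e.1.getD a.1.1 0 == B) && (P.2.2.1 &&& 2 ^ cell7 B (addU e.1 a.1.1 a.2) == 0) &&
      (P.2.2.2.1 &&& nbMask d B (addU e.1 a.1.1 a.2) == 0)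

end Units

/-! ### The step and the symmetries -/

/-- Fast kernel SAW step on dangerous-set states (mirror of `mstep`): refused iff the new vertex `e_a` is remembered; otherwise
shift by `-e_a`, age, insert the site just left with age `1` IN FRONT, drop sites out of reach (order preserved). [folklore] -/
def mstepF (d B τ : ℕ) (L : FState) (a : Fin d × Bool) : Option FState :=
  if L.any (fun e => e.1 == unitF d B a) then none
  else some ((unitF d B (a.1, !a.2), 1) :: L.filterMap fun e =>
    if e.2 + 1 ≤ τ - 1 ∧ l1F B (addU e.1 a.1.1 (!a.2)) ≤ τ - (e.2 + 1) then some (addU e.1 a.1.1 (!a.2), e.2 + 1) else none)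

/-- Apply a signed coordinate permutation table (source coordinate, keep-sign) to a shifted site (`x ↦ 2B - x` flips). [folklore] -/
def actF (B : ℕ) (gl : List (ℕ × Bool)) (v : List ℕ) : List ℕ :=
  gl.map fun sk => if sk.2 then v.getD sk.1 0 else 2 * B - v.getD sk.1 0

/-- Apply a symmetry table to a fast kernel state (order preserved). [folklore] -/
def actFS (B : ℕ) (gl : List (ℕ × Bool)) (L : FState) : FState := L.map fun e => (actF B gl e.1, e.2)

/-! ### Well-formedness -/

/-- Well-formed fast state: every site has `d` coordinates, all in `[2, 2B-2]`, and every age is `≥ 1`. [folklore] -/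
def WFF (d B : ℕ) (L : FState) : Bool :=
  L.all fun e => (e.1.length == d) && decide (1 ≤ e.2) && e.1.all fun x => decide (2 ≤ x) && decide (x + 2 ≤ 2 * B)

/-! ### Tables -/

/-- Certificate table: search tree keyed by row index, payload = (weight `V`, packed state `S`, successor data `J`). [folklore] -/
inductive FT where
  | leaf : FT
  | node : FT → ℕ → ℕ → ℕ → List ℕ → FT → FT

/-- Lookup by row index (the lookup function IS the table; no invariant assumed). [folklore] -/
def FT.find (i : ℕ) : FT → Option (ℕ × ℕ × List ℕ)
  | FT.leaf => none
  | FT.node l k v s j r => if i < k then l.find i else if k < i then r.find i else some (v, s, j)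

/-- Unpack `d` base-`64` coordinates. [folklore] -/
def unpack64 : ℕ → ℕ → List ℕ
  | 0, _ => []
  | k + 1, p => p % 64 :: unpack64 k (p / 64)

/-- Decode a packed state: base-`32` digits `q` from age `1` upwards, `q = 0` stop, otherwise letter number `(q-1)/2` is the
unit move (even = `+`, odd = `-`, coordinate `(q-1)/4`) from the previous site to this one and `(q-1) % 2 = 1` marks a remembered
site; positions are accumulated as base-`64` codes.  (Pure data decoding: no theorem about it is needed or claimed.) [folklore] -/
def decS (d : ℕ) : ℕ → ℕ → ℕ → ℕ → FState
  | 0, _, _, _ => []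
  | fuel + 1, s, p, g =>
    match s % 32 with
    | 0 => []
    | q + 1 =>
      let p' := if q / 2 % 2 = 0 then p + 64 ^ (q / 4) else p - 64 ^ (q / 4)
      if q % 2 = 1 then (unpack64 d p', g + 1) :: decS d fuel (s / 32) p' (g + 1) else decS d fuel (s / 32) p' (g + 1)

/-- The state of a packed row. [folklore] -/
def stateOf (d B τ : ℕ) (s : ℕ) : FState := decS d τ s (code64 (origF d B)) 0

/-- Decode one successor datum: `0` = rejection, else `1 + c + nsym · j` = (row `j`, symmetry number `c`). [folklore] -/
def decJ (nsym f : ℕ) : Option (ℕ × ℕ) := if f = 0 then none else some ((f - 1) / nsym, (f - 1) % nsym)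

section Check

variable (d B τ kc N nsym pn S T M D lamN lamD : ℕ) (syms : List (List (ℕ × Bool))) (t : FT)

/-- The (decoded) state of row `i` (empty if absent). [folklore] -/
def stOfF (i : ℕ) : FState := match t.find i with
  | some v => stateOf d B τ v.2.1
  | none => []

/-- The weight of row `i` (`1` if absent). [folklore] -/
def vOfF (i : ℕ) : ℕ := match t.find i with
  | some v => v.1
  | none => 1

/-- The successor datum of row `i` at letter number `k`. [folklore] -/
def scOfF (i k : ℕ) : Option (ℕ × ℕ) := match t.find i with
  | some v => decJ nsym (v.2.2.getD k 0)
  | none => none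

/-- Boolean equality of coordinate lists (`Nat.beq` per coordinate). [folklore] -/
def eqL : List ℕ → List ℕ → Bool
  | [], [] => true
  | x :: v, y :: w => Nat.beq x y && eqL v w
  | _, _ => false

/-- Boolean equality of fast kernel states. [folklore] -/
def eqFS : FState → FState → Bool
  | [], [] => true
  | e :: L, e' :: L' => Nat.beq e.2 e'.2 && eqL e.1 e'.1 && eqFS L L'
  | _, _ => false

/-- The MATCH test of one letter: a recomputed rejection must be listed as a rejection; a recomputed successor must be, as a
LIST, the listed row's state moved by the listed symmetry. [folklore] -/
def termOKF (L : FState) (a : Fin d × Bool) (os : Option (ℕ × ℕ)) : Bool :=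
  match mstepF d B τ L a, os with
  | none, none => true
  | some T', some (j, c) => decide (j < N) && eqFS T' (actFS B (syms.getD c []) (stOfF d B τ t j))
  | _, _ => false

/-- The integer value of one letter of a row (same surrogate arithmetic as `BondK.termValM`, exponents from the probes). [folklore] -/
def termValF (P : LMap) (L : FState) (a : Fin d × Bool) (os : Option (ℕ × ℕ)) : ℕ :=
  match os with
  | none => 0
  | some jc => pn * BondK.CFnum d pn S T D (chordF d B P a) *
      S ^ (cdetF d B τ kc P a - utF d B P a - umF d B P a) * T ^ utF d B P a * M ^ umF d B P a *
      D ^ (6 * d - ((cdetF d B τ kc P a - utF d B P a - umF d B P a) + utF d B P a + umF d B P a)) *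
      (if cornerF d B P L a then D * D + S * S else 2 * (D * D)) * vOfF t jc.1

/-- The integer row sum. [folklore] -/
def rowValF (P : LMap) (L : FState) (sc : ℕ → Option (ℕ × ℕ)) : ℕ :=
  ((letters d).map fun a => termValF d B τ kc pn S T M D t P L a (sc (letterIdx a))).sum

/-- **The fast row check**: the row exists, its decoded state is well formed, its local map passes the self-check, its weight
is positive, every letter matches the recomputed step, and the integer Collatz–Wielandt inequality holds. [folklore] -/
def checkRowF (i : ℕ) : Bool :=
  match t.find i with
  | none => false
  | some v =>
    let L := stateOf d B τ v.2.1
    let P := locOf B kc L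
    WFF d B L && selfOK P && decide (1 ≤ v.1) &&
      (letters d).all (fun a => termOKF d B τ N syms t L a (decJ nsym (v.2.2.getD (letterIdx a) 0))) &&
      decide (lamD * rowValF d B τ kc pn S T M D t P L (fun k => decJ nsym (v.2.2.getD k 0)) ≤
        lamN * (2 * S ^ 2 * T ^ (2 * d - 1) * D ^ (6 * d + 3)) * v.1)

end Check

end BondF

end Summit.CriticalPhenomena.PercolationContinuityZ3.Theorems.Pcint
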